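import Summits.QuantumFields.BalabanUV.T4Continuum.Support.NE7MinActHessianFlat
import Summits.QuantumFields.BalabanUV.T4Continuum.Support.NE3FlatHessianCurl
import Summits.QuantumFields.BalabanUV.T4Continuum.Support.NE3HessForm
import HarnessLib

/-!
# NE7MinActHessianFlatCurl — THE HESSIAN OF THE CONSTRAINED MINIMAL ACTION AT THE FLAT DATUM IN CLOSED FORM: `D²m(0)[v,v] = w · min { Σ_{p} ‖(d X)(p)‖²_{HS∕n} : X skew, Q′X = v }`
# (ROAD-G115 §2: the variational quadratic form of ✓ `NE7MinActHessianFlat` IDENTIFIED with the free lattice Maxwell form — the «⟨B, Δ_k B⟩ = inf_{QA = B} ‖dA‖²» principle of Bałaban)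

The second variation of the fine Wilson action in the exponential chart at the flat configuration is the normalised Hilbert–Schmidt square of the lattice curl:
`D²𝒜(0)[X, X] = Σ_{p ∈ W} nhsNormSq (curl 1 X p)` for every skew periodic-box field `X` (**`flat_second_variation`**: ✓ `NE3HessForm.hasDerivAt_fineAction_vary_at` ∕
`hasDerivAt_dAction_vary_at` along `t ↦ chart_1(tX) = 1·e^{tX}` (`chart_smul`), ✓ `NE3FlatHessianCurl.hess_flatCfg_eq_sum_nhsNormSq`, and the bridge `fderiv∘fderiv ↔ deriv∘deriv` via
`iteratedFDeriv_two_apply`), so ✓ `NE7MinActHessianFlat.minAct_hessian_flat` reads: **`minAct_hessian_flat_curl`** — for `0 < ε ≤ ε₀`, `N ≥ 1`, every level `j+1` and every coarse direction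
`v ∈ skewSub N`, `D²(minAct∘chart_1)(0)[v, v]` is the LEAST element of `{ w·Σ_{p ∈ W} ‖curl_1(X)(p)‖²_{nHS} : X ∈ skewSub(L·tower j), levelQ′ 1 X = v }` (`w = stepWt⁻ʲ⁻¹`,
`W` = the plaquettes of the period box), the minimum attained.
Cell `pub-balaban`, rung (B)+1 sub-cell t4, lineage `b2b-balaban-t4-ne7-p1` (CRUX PROVER NE7 #1 = OWNER of BINDER row NE7), generation 115.  Memo `t4/b2b-balaban-t4-ne7-p1-g115/ROAD-G115.md` §2.
WHAT ([folklore]; 0 def, 0 sorry; `d = 4`, every `U(n)`, `L ≥ 2`).  HONEST FRAMING (page 1): OUR constrained minimisation (B11 (8) with `sfClass`) at the flat datum; a VARIATIONAL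
characterisation with the free quadratic form written out — NOT Bałaban's operator formula for `Δ_k`, no spectral bounds, no uniformity in `k`, no axial gauge; nothing of Bałaban's asserted;
NOT NE7 as a spine node, NOT NE3; spine 0∕9; finite T⁴ rung (B)+1 — NOT infinite volume, NOT mass gap, NOT BetaPertH, NOT Clay.
-/

set_option autoImplicit false

open scoped BigOperators Matrix Matrix.Norms.L2Operator Topology
open NormedSpace Finset Set Filter Metric

namespace Summit.QuantumFields.BalabanUV.T4Continuum.NE7MinActHessianFlatCurl

open Literature.MathematicalPhysics.QuantumFieldTheory.Balaban1983to89
open B7Prop1Explicit B7Prop2Explicit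
open T4AveragingDeficitWall (IsSkewDir fineAction vary vary_zero curl)
open AveragingDeficitTorusChart (TDir chart chartDir chart_smul)
open AveragingDeficitChartCalculus (contDiffAt_fineAction_chart)
open AveragingDeficitTwoLevelPrep (skewSub)
open AveragingDeficitMultiLevelPrep (tower levelQ' tower_ne_zero)
open MinimalActionLevels (perWin stepWt)
open MinimalActionSandwich (minAct)
open MinimalActionRate (sfClass)
open MinimalActionWitness (flatCfg)
open MatrixNorms (nhsNormSq)
open NE3HessForm (dAction hess hasDerivAt_fineAction_vary_at hasDerivAt_dAction_vary_at)
open NE3FlatHessianCurl (hess_flatCfg_eq_sum_nhsNormSq)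
open NE7SecondOrderChainRule (fderiv_fderiv_comp_clm)
open NE7MinActHessianFlat (minAct_hessian_flat)

noncomputable section

variable {n : Type} [Fintype n] [DecidableEq n]

/-- Bridge between the Fréchet and the one-variable second derivative of a real function: `D²ψ(t)[1,1] = ψ″(t)`. [folklore] -/
theorem fderiv_fderiv_one_one (ψ : ℝ → ℝ) (t : ℝ) : fderiv ℝ (fderiv ℝ ψ) t 1 1 = deriv (deriv ψ) t := by
  have h1 : iteratedDeriv 2 ψ t = fderiv ℝ (fderiv ℝ ψ) t 1 1 := by
    rw [iteratedDeriv_eq_iteratedFDeriv, iteratedFDeriv_two_apply]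
  rw [← h1, iteratedDeriv_succ, iteratedDeriv_one]

/-- **THE SECOND VARIATION OF THE WILSON ACTION AT THE FLAT CONFIGURATION IS THE HILBERT–SCHMIDT SQUARE OF THE CURL**: for a skew periodic-box field `X`,
`D²(fineAction ∘ chart_1)(0)[X, X] = Σ_{p ∈ W} nhsNormSq (curl 1 X p)`. [folklore] -/
theorem flat_second_variation [Nonempty n] {M : ℕ} [NeZero M] (W : Finset (T4AveragingDeficitWall.Plaq 4)) (X : ↥(skewSub 4 n M)) :
    fderiv ℝ (fderiv ℝ (fun Φ : ↥(skewSub 4 n M) => fineAction (chart (ContinuousLinearMap.id ℝ (Matrix n n ℂ)) M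
      (flatCfg : Site 4 → Fin 4 → (Matrix n n ℂ)ˣ) (Φ : TDir 4 n M)) W)) 0 X X
      = ∑ p ∈ W, nhsNormSq (curl (flatCfg : Site 4 → Fin 4 → (Matrix n n ℂ)ˣ) (chartDir (ContinuousLinearMap.id ℝ (Matrix n n ℂ)) M (X : TDir 4 n M)) p) := by
  set V₀ : Site 4 → Fin 4 → (Matrix n n ℂ)ˣ := flatCfg with hV₀
  set A : ↥(skewSub 4 n M) → ℝ := fun Φ => fineAction (chart (ContinuousLinearMap.id ℝ (Matrix n n ℂ)) M V₀ (Φ : TDir 4 n M)) W with hA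
  set Y : Site 4 → Fin 4 → Matrix n n ℂ := chartDir (ContinuousLinearMap.id ℝ (Matrix n n ℂ)) M (X : TDir 4 n M) with hY
  have hYskew : IsSkewDir Y := fun x κ => X.2 (AveragingDeficitTorusChart.redN M x) κ
  set ℓ : ℝ →L[ℝ] ↥(skewSub 4 n M) := ContinuousLinearMap.toSpanSingleton ℝ X with hℓ
  -- the one-parameter family `t ↦ 𝒜(tX) = A_W(1·e^{tY})`
  have hψ : (fun t : ℝ => A (ℓ t)) = fun t : ℝ => fineAction (vary V₀ Y t) W := by
    funext t
    simp only [hA, hℓ, ContinuousLinearMap.toSpanSingleton_apply, Submodule.coe_smul, chart_smul, hY]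
  have hd1 : deriv (fun t : ℝ => A (ℓ t)) = fun t : ℝ => dAction (vary V₀ Y t) Y W := by
    rw [hψ]; funext t; exact (hasDerivAt_fineAction_vary_at V₀ Y W t).deriv
  have hd2 : deriv (deriv (fun t : ℝ => A (ℓ t))) 0 = hess V₀ Y Y W := by
    rw [hd1, (hasDerivAt_dAction_vary_at V₀ Y W 0).deriv, vary_zero]
  -- Fréchet side: `D²(A∘ℓ)(0)[1,1] = D²A(0)[X,X]`
  have hAc : ContDiffAt ℝ 2 A (ℓ 0) := by
    rw [map_zero]
    have h1 : ContDiffAt ℝ 2 (fun Φ : TDir 4 n M => fineAction (chart (ContinuousLinearMap.id ℝ (Matrix n n ℂ)) M V₀ Φ) W) ((skewSub 4 n M).subtypeL 0) := by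
      rw [map_zero]; exact contDiffAt_fineAction_chart (m := 2) (ContinuousLinearMap.id ℝ (Matrix n n ℂ)) M V₀ W 0
    exact h1.comp 0 (skewSub 4 n M).subtypeL.contDiff.contDiffAt
  have hF := fderiv_fderiv_comp_clm ℓ hAc (1 : ℝ) 1
  rw [map_zero, ContinuousLinearMap.toSpanSingleton_apply_one] at hF
  rw [← hF, fderiv_fderiv_one_one, hd2, hV₀, hess_flatCfg_eq_sum_nhsNormSq hYskew]

/-- **THE HESSIAN OF THE CONSTRAINED MINIMAL ACTION AT THE FLAT DATUM, CLOSED FORM** (see the module docstring): `D²(minAct∘chart_1)(0)[v,v]` is the least element of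
`{ w·Σ_{p∈W} nhsNormSq (curl 1 (chartDir X) p) : X ∈ skewSub M, levelQ′ 1 X = v }`. [folklore] -/
theorem minAct_hessian_flat_curl [Nonempty n] {L : ℕ} [NeZero L] (hL : 2 ≤ L) :
    ∃ ε₀ : ℝ, 0 < ε₀ ∧ ∀ ε : ℝ, 0 < ε → ε ≤ ε₀ → ∀ (N : ℕ) [NeZero N], 1 ≤ N → ∀ j : ℕ,
      ContDiffAt ℝ 2 (fun y : ↥(skewSub 4 n N) => minAct 4 (sfClass 4 L N ε) L N (j + 1)
        (chart (ContinuousLinearMap.id ℝ (Matrix n n ℂ)) N (flatCfg : Site 4 → Fin 4 → (Matrix n n ℂ)ˣ) (y : TDir 4 n N))) 0 ∧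
      ∀ v : ↥(skewSub 4 n N),
        IsLeast {q : ℝ | ∃ X : ↥(skewSub 4 n (L * tower L N j)),
            levelQ' L N j (flatCfg : Site 4 → Fin 4 → (Matrix n n ℂ)ˣ) (X : TDir 4 n (L * tower L N j)) = v ∧
            q = ((stepWt 4 L)⁻¹) ^ (j + 1) * ∑ p ∈ perWin 4 (N * L ^ (j + 1)),
              nhsNormSq (curl (flatCfg : Site 4 → Fin 4 → (Matrix n n ℂ)ˣ) (chartDir (ContinuousLinearMap.id ℝ (Matrix n n ℂ)) (L * tower L N j) (X : TDir 4 n (L * tower L N j))) p)}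
          (fderiv ℝ (fderiv ℝ (fun y : ↥(skewSub 4 n N) => minAct 4 (sfClass 4 L N ε) L N (j + 1)
            (chart (ContinuousLinearMap.id ℝ (Matrix n n ℂ)) N (flatCfg : Site 4 → Fin 4 → (Matrix n n ℂ)ˣ) (y : TDir 4 n N)))) 0 v v) := by
  obtain ⟨ε₀, hε₀, H⟩ := minAct_hessian_flat (n := n) hL
  refine ⟨ε₀, hε₀, fun ε hε hεle N _ hN j => ?_⟩
  obtain ⟨hC2, hleast⟩ := H ε hε hεle N hN j
  haveI : NeZero (L * tower L N j) := ⟨Nat.mul_ne_zero (NeZero.ne L) (tower_ne_zero L N j)⟩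
  refine ⟨hC2, fun v => ?_⟩
  have hset : {q : ℝ | ∃ X : ↥(skewSub 4 n (L * tower L N j)),
      levelQ' L N j (flatCfg : Site 4 → Fin 4 → (Matrix n n ℂ)ˣ) (X : TDir 4 n (L * tower L N j)) = v ∧
      q = ((stepWt 4 L)⁻¹) ^ (j + 1) * ∑ p ∈ perWin 4 (N * L ^ (j + 1)),
        nhsNormSq (curl (flatCfg : Site 4 → Fin 4 → (Matrix n n ℂ)ˣ) (chartDir (ContinuousLinearMap.id ℝ (Matrix n n ℂ)) (L * tower L N j) (X : TDir 4 n (L * tower L N j))) p)}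
      = {q : ℝ | ∃ X : ↥(skewSub 4 n (L * tower L N j)),
          levelQ' L N j (flatCfg : Site 4 → Fin 4 → (Matrix n n ℂ)ˣ) (X : TDir 4 n (L * tower L N j)) = v ∧
          q = ((stepWt 4 L)⁻¹) ^ (j + 1) * fderiv ℝ (fderiv ℝ (fun Φ : ↥(skewSub 4 n (L * tower L N j)) =>
            fineAction (chart (ContinuousLinearMap.id ℝ (Matrix n n ℂ)) (L * tower L N j) (flatCfg : Site 4 → Fin 4 → (Matrix n n ℂ)ˣ) (Φ : TDir 4 n (L * tower L N j)))
              (perWin 4 (N * L ^ (j + 1))))) 0 X X} := by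
    ext q
    simp only [Set.mem_setOf_eq, flat_second_variation]
  rw [hset]
  exact hleast v

end

end Summit.QuantumFields.BalabanUV.T4Continuum.NE7MinActHessianFlatCurl
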